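import Summits.QuantumAdvantage.QuantumAdvantage.Theorems.SosSandwichPseudoBoundedClosure
import Mathlib.RingTheory.Polynomial.Chebyshev
import Mathlib.Analysis.SpecialFunctions.Trigonometric.Chebyshev.Basic
import Mathlib.Analysis.SpecialFunctions.Trigonometric.Inverse

/-!
# Route `SosSandwich`, crux `PseudoBoundedAA` (stmt-QuantumAdvantage-15237) — the CHEBYSHEV FAMILY
`p_k = T_k(ȳ)²` lies in `K_k`: the amplitude-amplification calibrator of the `T`-exponent

Helper (`--supports stmt-QuantumAdvantage-15237`), conjecture-free, no named facts.

THE FAMILY. For `N ≥ 1` let `ȳ := (1/N)·Σᵢ (1 − 2xᵢ) ∈ [−1, 1]` be the sign mean of `x ∈ {0,1}^N`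
(total degree `1`) and, for `k ≥ 1`, `p_k := T_k(ȳ)²` with `T_k` the Chebyshev polynomial of the first
kind (Mathlib `Polynomial.Chebyshev.T ℝ k`), a polynomial of total degree `≤ 2k` with cube values
`p_k(x) = cos²(k · arccos ȳ(x))` (`evalBool_chebyshevT_sq_eq_cos_sq`). It is the polynomial-method
shadow of AMPLITUDE AMPLIFICATION: `k` Grover-type iterations driven by the one-query phase `ȳ`
produce exactly the profile `cos²(k θ)`, `cos θ = ȳ` — the mechanism behind the card's prediction
"(c, exponent of T) = (2, 2), forced by Grover + check" for PB-AA (route file, NUMBERS).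

MAIN THEOREM (`pseudoBounded_chebyshevT_sq`): **`p_k ∈ K_k` for every `N ≥ 1` and `k ≥ 1`**, with
ELEMENTARY certificates, uniform in `N` and `k`:
* `p_k = (T_k(ȳ))²` — one square of degree `≤ k`;
* `1 − p_k = (1 − ȳ²)·U_{k−1}(ȳ)²` by the PELL IDENTITY `T_k² + (1 − z²)·U_{k−1}² = 1`
  (`chebyshevT_sq_add_one_sub_X_sq_mul_U_sq`, proved here by the mixed `T/U` recurrences), and ON THE
  CUBE `1 − ȳ² = (2/N²)·Σ_{i,j} (xᵢ − xⱼ)²` (`(1 − 2xᵢ)² = 1`; `sum_sum_sq_sub_of_sq_eq_one`), so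
  `1 − p_k = Σ_{i,j} ((√2/N)(xᵢ − xⱼ)·U_{k−1}(ȳ))²`, squares of degree `≤ 1 + (k − 1) = k`.
So no quantum algorithm, unitary or SDP is needed to place the amplitude-amplification profile in the
SOS sandwich class: it is two lines of Chebyshev algebra (compare `QueryAcceptPseudoBounded`, which would
give the same through an explicit `k`-query algorithm).

EXACT STATISTICS (§4). With `t₂ := T_{2k}(ȳ)`, `t₄ := T_{4k}(ȳ)`: `p_k = (1 + t₂)/2`,
`(p_k − 1/2)² = (1 + t₄)/8` pointwise (half-angle formulas from `2·T_m·T_n = T_{m+n} + T_{m−n}`), hence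
`E p_k = 1/2 + E t₂/2` (`boolAvg_chebyshevT_sq`) and the EXACT VARIANCE IDENTITY
`Var[p_k] = 1/8 + E t₄/8 − (E t₂)²/4` (`boolVariance_chebyshevT_sq`); consequently
`Var[p_k] ≥ 5/64` as soon as `|E T_{2k}(ȳ)| ≤ 1/4` and `E T_{4k}(ȳ) ≥ −1/4`
(`boolVariance_chebyshevT_sq_ge`).

WHY IT MATTERS (calibration of the crux, `T`-side). On `N = k²` variables the family has (exact binomial
numerics, this seat, `k = 4 … 64`): `Var[p_k] → 0.1205` (`= 1/8 − e^{−4}/4 + O(e^{−16})`, from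
`E T_{2k}(ȳ) → e^{−2k²/N}`) while EVERY influence is `Infᵢ[p_k] = (2.00 + o(1))/k²` (all equal by
symmetry; `N = k²/2`: `Var → 0.1249`, `Infᵢ·k² → 8.0`; `N = 2k²`: `0.0935`, `0.49`). Granted the two
analytic inputs listed below, this forces `b ≥ 2` in ANY law `maxInf ≥ C·Var^a/T^b` valid on the whole
class `K = ⋃_T K_T` — complementing the `Var`-side calibration `a ≥ 2` (disjointly averaged address
family, `SosSandwichHomogeneousPBAATExponent/Averaging.lean`) and showing that the corner `(a, b) = (2, 1)`
("`maxInf ≥ C·Var²/T`", attained on the TOP-HOMOGENEOUS subclass, `…ExponentCorner.lean`) is special to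
the top level: off the top level the `T`-loss of PB-AA is at least quadratic, and `(2, 2)` is the unique
strongest candidate on `K` (the card's prediction). For the single-exponent item `PseudoBoundedAA`
(`C·(ε/T)^c`) this is a second, independent reason for `c ≥ 2`.

WHAT IS *NOT* PROVED HERE (remaining analytic inputs, each elementary but binomial-heavy; sizes for a
successor): (R1, size M) the oscillatory averages `|E_x T_{2k}(ȳ)| ≤ 1/4`, `E_x T_{4k}(ȳ) ≥ −1/4` for
`N ∈ [k²/2, 2k²]`, `k ≥ k₀` (needs a binomial window estimate: `C(2n, n+t)/4^n ≥ (1 − t²/n)/(2√n)` for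
`|t| ≤ √n`, plus `cos² ≥ 3/4` / `≤ 1/4` on the phase windows — or any CLT-free anti-concentration of
`Σ yᵢ` at scale `√N` inside a bounded annulus); (R2, size S/M) the influence bound
`Infᵢ[p_k] ≤ 4/N + (5k/(2N))²` (`≤ 11/k²` at `N = k²`): cube Chebyshev tail `P[|ȳ| ≥ 1/2] ≤ 4/N`
(second moment `E ȳ² = 1/N`) plus the interior Bernstein bound `|d/dz T_k(z)²| = k|sin(2kθ)|/sin θ ≤ 5k/4`
on `|z| ≤ 3/5` (`T_k' = k·U_{k−1}`, `U_{k−1}(cos θ)·sin θ = sin kθ`) and the mean value inequality.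
With (R1) ∧ (R2): `Var ≥ 5/64 ∧ maxInf ≤ 11/k²` on `N = k²`, i.e. the `b ≥ 2` calibration in the kernel.

All statements are written over the tree vocabulary `PseudoBounded` / `evalBool` / `boolAvg` /
`boolVariance` (definitionally the route file's inline `ev` / `avg`), with the family spelled out
explicitly (no new definitions): `ȳ` is `Σᵢ (C (1/N) − C (2/N)·Xᵢ)` and `p_k` is
`(Polynomial.aeval ȳ (Chebyshev.T ℝ k))²`.

Sources: Polynomial method / amplitude amplification profiles [cite: BealsEtAl2001, §4];
sos degree = query complexity in expectation (the class `K_T`) [cite: KaniewskiLeeDewolf2015, Def. 7, Thm. 12];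
Chebyshev polynomials, Pell identity and half-angle formulas [folklore]; route file
`Theses/SosSandwich.lean` (NUMBERS, NOT DECOMPOSED YET: "the sharp exponents (maxInf ≥ c·Var²/T²)").
-/

set_option linter.dupNamespace false

noncomputable section

namespace Summit.QuantumAdvantage.QuantumAdvantage.Theorems.SosSandwich

open Finset
open Literature.Computability.QuantumComplexity

variable {N : ℕ}

/-! ### §1 The Pell identity `T_k² + (1 − z²)·U_{k−1}² = 1` -/

/-- **Pell identity for the Chebyshev polynomials** (as polynomials over `ℝ`):
`T_n² + (1 − X²)·U_{n−1}² = 1` for every `n : ℕ` (with Mathlib's `U_{−1} = 0` at `n = 0`).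
Proof: the quantity is invariant under `n ↦ n + 1` by the mixed recurrences
`T_{n+1} = X·T_n − (1 − X²)·U_{n−1}` and `U_n = X·U_{n−1} + T_n`. [folklore] -/
theorem chebyshevT_sq_add_one_sub_X_sq_mul_U_sq (n : ℕ) :
    Polynomial.Chebyshev.T ℝ (n : ℤ) ^ 2 +
      (1 - Polynomial.X ^ 2) * Polynomial.Chebyshev.U ℝ ((n : ℤ) - 1) ^ 2 = 1 := by
  induction n with
  | zero => simp
  | succ n ih =>
    have h1 := Polynomial.Chebyshev.T_eq_X_mul_T_sub_pol_U ℝ ((n : ℤ) - 1)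
    have h2 := Polynomial.Chebyshev.U_eq_X_mul_U_add_T ℝ ((n : ℤ) - 1)
    have e1 : (n : ℤ) - 1 + 2 = (n : ℤ) + 1 := by ring
    have e2 : (n : ℤ) - 1 + 1 = (n : ℤ) := by ring
    rw [e1, e2] at h1
    rw [e2] at h2
    push_cast
    have e3 : (n : ℤ) + 1 - 1 = (n : ℤ) := by ring
    rw [e3]
    linear_combination (Polynomial.Chebyshev.T ℝ ((n : ℤ) + 1) + Polynomial.X * Polynomial.Chebyshev.T ℝ (n : ℤ)
        - (1 - Polynomial.X ^ 2) * Polynomial.Chebyshev.U ℝ ((n : ℤ) - 1)) * h1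
      + (1 - Polynomial.X ^ 2) * (Polynomial.Chebyshev.U ℝ (n : ℤ)
        + Polynomial.X * Polynomial.Chebyshev.U ℝ ((n : ℤ) - 1) + Polynomial.Chebyshev.T ℝ (n : ℤ)) * h2 + ih

/-- The Pell identity at a real point: `T_n(z)² + (1 − z²)·U_{n−1}(z)² = 1`. [folklore] -/
theorem eval_chebyshevT_sq_add (n : ℕ) (z : ℝ) :
    (Polynomial.Chebyshev.T ℝ (n : ℤ)).eval z ^ 2 +
      (1 - z ^ 2) * (Polynomial.Chebyshev.U ℝ ((n : ℤ) - 1)).eval z ^ 2 = 1 := by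
  have h := congrArg (Polynomial.eval z) (chebyshevT_sq_add_one_sub_X_sq_mul_U_sq n)
  simpa using h

/-- Half-angle formula `T_k(z)² = (1 + T_{2k}(z))/2` (from `2·T_m·T_k = T_{m+k} + T_{m−k}`). [folklore] -/
theorem eval_chebyshevT_sq_eq_half (k : ℕ) (z : ℝ) :
    (Polynomial.Chebyshev.T ℝ (k : ℤ)).eval z ^ 2 =
      (1 + (Polynomial.Chebyshev.T ℝ (2 * (k : ℤ))).eval z) / 2 := by
  have h := congrArg (Polynomial.eval z) (Polynomial.Chebyshev.T_mul_T ℝ (k : ℤ) (k : ℤ))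
  simp only [Polynomial.eval_mul, Polynomial.eval_ofNat, sub_self, Polynomial.Chebyshev.T_zero,
    Polynomial.eval_one, Polynomial.eval_add] at h
  rw [two_mul (k : ℤ)]
  linear_combination h / 2

/-- `T_k(z)² = cos²(k·arccos z)` for `z ∈ [−1, 1]`. [folklore] -/
theorem eval_chebyshevT_sq_eq_cos_sq (k : ℕ) {z : ℝ} (hz₁ : -1 ≤ z) (hz₂ : z ≤ 1) :
    (Polynomial.Chebyshev.T ℝ (k : ℤ)).eval z ^ 2 = Real.cos (k * Real.arccos z) ^ 2 := by
  conv_lhs => rw [← Real.cos_arccos hz₁ hz₂]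
  rw [Polynomial.Chebyshev.T_real_cos]
  push_cast
  ring

/-! ### §2 The sign mean `ȳ = (1/N)·Σᵢ (1 − 2xᵢ)` and the degree-one SOS certificate of `1 − ȳ²` -/

/-- Cube values of the sign mean: `ȳ(x) = (1/N)·Σᵢ (1 − 2·xᵢ)`. [folklore] -/
theorem evalBool_signMean (x : Fin N → Bool) :
    evalBool (∑ i : Fin N, (MvPolynomial.C (1 / (N : ℝ)) -
        MvPolynomial.C (2 / (N : ℝ)) * MvPolynomial.X i)) x =
      (1 / (N : ℝ)) * ∑ i, (1 - 2 * (if x i then (1 : ℝ) else 0)) := by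
  unfold evalBool
  rw [map_sum, Finset.mul_sum]
  refine Finset.sum_congr rfl fun i _ => ?_
  rw [map_sub, map_mul, MvPolynomial.eval_C, MvPolynomial.eval_C, MvPolynomial.eval_X]
  ring

/-- The sign mean lies in `[−1, 1]` on the cube. [folklore] -/
theorem abs_evalBool_signMean_le (hN : 1 ≤ N) (x : Fin N → Bool) :
    |evalBool (∑ i : Fin N, (MvPolynomial.C (1 / (N : ℝ)) -
        MvPolynomial.C (2 / (N : ℝ)) * MvPolynomial.X i)) x| ≤ 1 := by
  rw [evalBool_signMean]
  have hN' : (0 : ℝ) < N := by exact_mod_cast hN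
  have hb : ∀ i, |(1 - 2 * (if x i then (1 : ℝ) else 0))| ≤ 1 := by
    intro i; cases x i <;> norm_num
  have hs : |∑ i, (1 - 2 * (if x i then (1 : ℝ) else 0))| ≤ N := by
    calc |∑ i, (1 - 2 * (if x i then (1 : ℝ) else 0))|
        ≤ ∑ i : Fin N, |(1 - 2 * (if x i then (1 : ℝ) else 0))| := Finset.abs_sum_le_sum_abs _ _
      _ ≤ ∑ _i : Fin N, (1 : ℝ) := Finset.sum_le_sum fun i _ => hb i
      _ = N := by simp
  rw [abs_mul, abs_of_pos (by positivity : (0 : ℝ) < 1 / N), one_div, inv_mul_le_iff₀ hN']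
  simpa using hs

/-- The sign mean has total degree `≤ 1`. [folklore] -/
theorem totalDegree_signMean_le :
    (∑ i : Fin N, (MvPolynomial.C (1 / (N : ℝ)) -
        MvPolynomial.C (2 / (N : ℝ)) * MvPolynomial.X i)).totalDegree ≤ 1 := by
  refine (MvPolynomial.totalDegree_finsetSum _ _).trans (Finset.sup_le fun i _ => ?_)
  refine (MvPolynomial.totalDegree_sub _ _).trans (max_le ?_ ?_)
  · rw [MvPolynomial.totalDegree_C]; exact Nat.zero_le _
  · refine (MvPolynomial.totalDegree_mul _ _).trans ?_
    rw [MvPolynomial.totalDegree_C, MvPolynomial.totalDegree_X, zero_add]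

/-- Algebra of the certificate: for signs `eᵢ` with `eᵢ² = 1`,
`Σᵢ Σⱼ (eᵢ − eⱼ)² = 2·N² − 2·(Σᵢ eᵢ)²`. [folklore] -/
theorem sum_sum_sq_sub_of_sq_eq_one (e : Fin N → ℝ) (he : ∀ i, e i ^ 2 = 1) :
    ∑ i, ∑ j, (e i - e j) ^ 2 = 2 * (N : ℝ) ^ 2 - 2 * (∑ i, e i) ^ 2 := by
  have h1 : ∀ i j, (e i - e j) ^ 2 = 2 - 2 * (e i * e j) := by
    intro i j; have := he i; have := he j; ring_nf; nlinarith
  calc ∑ i, ∑ j, (e i - e j) ^ 2 = ∑ i, ∑ j, (2 - 2 * (e i * e j)) := by simp_rw [h1]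
    _ = ∑ i, (2 * (N : ℝ) - 2 * (e i * ∑ j, e j)) := by
        refine Finset.sum_congr rfl fun i _ => ?_
        rw [Finset.sum_sub_distrib, Finset.sum_const, Finset.card_univ, Fintype.card_fin,
          ← Finset.mul_sum, ← Finset.mul_sum]
        simp only [nsmul_eq_mul]
        ring
    _ = 2 * (N : ℝ) ^ 2 - 2 * (∑ i, e i) ^ 2 := by
        rw [Finset.sum_sub_distrib, Finset.sum_const, Finset.card_univ, Fintype.card_fin,
          ← Finset.mul_sum, ← Finset.sum_mul]
        simp only [nsmul_eq_mul]
        ring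

/-! ### §3 The Chebyshev family `p_k = T_k(ȳ)²` lies in `K_k`, for every `N ≥ 1` and `k ≥ 1` -/

/-- Cube evaluation commutes with univariate substitution: `(Q ∘ s)(x) = Q(s(x))`. [folklore] -/
theorem evalBool_aeval (s : MvPolynomial (Fin N) ℝ) (Q : Polynomial ℝ) (x : Fin N → Bool) :
    evalBool (Polynomial.aeval s Q) x = Q.eval (evalBool s x) := by
  unfold evalBool
  rw [← MvPolynomial.aeval_eq_eval, ← Polynomial.aeval_algHom_apply, Polynomial.coe_aeval_eq_eval]

/-- Degree of a univariate substitution: `deg (Q ∘ s) ≤ deg Q · deg s`. [folklore] -/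
theorem totalDegree_aeval_le (s : MvPolynomial (Fin N) ℝ) (Q : Polynomial ℝ) :
    (Polynomial.aeval s Q).totalDegree ≤ Q.natDegree * s.totalDegree := by
  rw [Polynomial.aeval_eq_sum_range]
  refine (MvPolynomial.totalDegree_finsetSum _ _).trans (Finset.sup_le fun i hi => ?_)
  have hi' : i ≤ Q.natDegree := Nat.lt_succ_iff.mp (Finset.mem_range.mp hi)
  exact (MvPolynomial.totalDegree_smul_le _ _).trans
    ((MvPolynomial.totalDegree_pow _ _).trans (Nat.mul_le_mul_right _ hi'))

/-- **The Chebyshev family is SOS-sandwiched: `T_k(ȳ)² ∈ K_k`** for all `N ≥ 1`, `k ≥ 1`, where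
`ȳ = (1/N)·Σᵢ (1 − 2xᵢ)` is the sign mean. Certificates (elementary, `N`- and `k`-uniform):
`p = (T_k(ȳ))²` with `deg T_k(ȳ) ≤ k`, and by the Pell identity
`1 − p = (1 − ȳ²)·U_{k−1}(ȳ)² = Σ_{i,j} ((√2/N)·(xᵢ − xⱼ)·U_{k−1}(ȳ))²` on the cube, each of degree
`≤ 1 + (k − 1) = k`, using `1 − ȳ² = (2/N²)·Σ_{i,j} (xᵢ − xⱼ)²` there (`(1 − 2xᵢ)² = 1`).
This is the polynomial-method shadow of amplitude amplification (`k` Grover-type iterations driven by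
the one-query phase `ȳ`): an explicit member of `K_k` of degree `2k` whose profile oscillates on the
scale `1/k` in `ȳ`. [folklore] -/
theorem pseudoBounded_chebyshevT_sq (k : ℕ) (hk : 1 ≤ k) (hN : 1 ≤ N) :
    PseudoBounded k
      ((Polynomial.aeval (∑ i : Fin N, (MvPolynomial.C (1 / (N : ℝ)) -
          MvPolynomial.C (2 / (N : ℝ)) * MvPolynomial.X i)) (Polynomial.Chebyshev.T ℝ (k : ℤ))) ^ 2) := by
  set s : MvPolynomial (Fin N) ℝ := ∑ i : Fin N, (MvPolynomial.C (1 / (N : ℝ)) -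
      MvPolynomial.C (2 / (N : ℝ)) * MvPolynomial.X i) with hs
  have hsdeg : s.totalDegree ≤ 1 := totalDegree_signMean_le
  have hN0 : (N : ℝ) ≠ 0 := by exact_mod_cast (show N ≠ 0 by omega)
  obtain ⟨j, rfl⟩ : ∃ j, k = j + 1 := ⟨k - 1, by omega⟩
  have ecast : ((j + 1 : ℕ) : ℤ) - 1 = (j : ℤ) := by push_cast; ring
  rw [pseudoBounded_iff_cubeSOS]
  constructor
  · -- `p = (T_k(ȳ))²`, one square of degree `≤ k`
    refine (CubeSOS.sq (Polynomial.aeval s (Polynomial.Chebyshev.T ℝ ((j + 1 : ℕ) : ℤ))) ?_).congr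
      fun x => ?_
    · refine (totalDegree_aeval_le _ _).trans ?_
      rw [Polynomial.Chebyshev.natDegree_T, Int.natAbs_natCast]
      simpa using Nat.mul_le_mul_left (j + 1) hsdeg
    · unfold evalBool; rw [map_pow]
  · -- `1 − p = (1 − ȳ²)·U_{k−1}(ȳ)²`, with `1 − ȳ² = (2/N²) Σ_{i,j} (xᵢ − xⱼ)²` on the cube
    have hsos1 : CubeSOS 1 (fun x => 1 - evalBool s x ^ 2) := by
      refine ((CubeSOS.sum (Finset.univ : Finset (Fin N × Fin N))
        (fun ij x => evalBool (MvPolynomial.X ij.1 - MvPolynomial.X ij.2) x ^ 2)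
        (fun ij _ => CubeSOS.sq _ ?_)).smul (show (0 : ℝ) ≤ 2 / (N : ℝ) ^ 2 by positivity)).congr
        fun x => ?_
      · refine (MvPolynomial.totalDegree_sub _ _).trans (max_le ?_ ?_) <;>
          rw [MvPolynomial.totalDegree_X]
      · -- the identity `1 − ȳ(x)² = (2/N²) Σ_{(i,j)} (xᵢ − xⱼ)²`
        have key := sum_sum_sq_sub_of_sq_eq_one (fun i => 1 - 2 * (if x i then (1 : ℝ) else 0))
          (fun i => by cases x i <;> norm_num)
        rw [← Finset.univ_product_univ, Finset.sum_product]
        have hterm : ∀ i j : Fin N, evalBool (MvPolynomial.X i - MvPolynomial.X j) x ^ 2 =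
            ((1 - 2 * (if x i then (1 : ℝ) else 0)) - (1 - 2 * (if x j then (1 : ℝ) else 0))) ^ 2 / 4 := by
          intro i j
          unfold evalBool
          rw [map_sub, MvPolynomial.eval_X, MvPolynomial.eval_X]
          ring
        rw [hs, evalBool_signMean]
        simp_rw [hterm, ← Finset.sum_div]
        rw [key]
        field_simp
        ring
    have hsos2 : CubeSOS j (fun x => evalBool (Polynomial.aeval s
        (Polynomial.Chebyshev.U ℝ (((j + 1 : ℕ) : ℤ) - 1))) x ^ 2) := by
      refine CubeSOS.sq _ ((totalDegree_aeval_le _ _).trans ?_)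
      rw [ecast, Polynomial.Chebyshev.natDegree_U_natCast]
      simpa using Nat.mul_le_mul_left j hsdeg
    refine ((hsos1.mul hsos2).mono (by omega)).congr fun x => ?_
    -- Pell at `z = ȳ(x)`
    have pell := eval_chebyshevT_sq_add (j + 1) (evalBool s x)
    have hT : evalBool ((Polynomial.aeval s (Polynomial.Chebyshev.T ℝ ((j + 1 : ℕ) : ℤ))) ^ 2) x =
        (Polynomial.Chebyshev.T ℝ ((j + 1 : ℕ) : ℤ)).eval (evalBool s x) ^ 2 := by
      rw [← evalBool_aeval]; unfold evalBool; rw [map_pow]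
    have hU := evalBool_aeval s (Polynomial.Chebyshev.U ℝ (((j + 1 : ℕ) : ℤ) - 1)) x
    rw [hT, hU]
    linear_combination (-1 : ℝ) * pell

/-- Cube values of the family: `p_k(x) = T_k(ȳ(x))²`. [folklore] -/
theorem evalBool_chebyshevT_sq (k : ℕ) (x : Fin N → Bool) :
    evalBool ((Polynomial.aeval (∑ i : Fin N, (MvPolynomial.C (1 / (N : ℝ)) -
          MvPolynomial.C (2 / (N : ℝ)) * MvPolynomial.X i)) (Polynomial.Chebyshev.T ℝ (k : ℤ))) ^ 2) x =
      (Polynomial.Chebyshev.T ℝ (k : ℤ)).eval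
        ((1 / (N : ℝ)) * ∑ i, (1 - 2 * (if x i then (1 : ℝ) else 0))) ^ 2 := by
  rw [← evalBool_signMean x, ← evalBool_aeval]
  unfold evalBool
  rw [map_pow]

/-- Trigonometric form of the cube values (`N ≥ 1`): `p_k(x) = cos²(k · arccos ȳ(x))` — the
amplitude-amplification profile, oscillating on the scale `1/k` in the sign mean `ȳ`. [folklore] -/
theorem evalBool_chebyshevT_sq_eq_cos_sq (k : ℕ) (hN : 1 ≤ N) (x : Fin N → Bool) :
    evalBool ((Polynomial.aeval (∑ i : Fin N, (MvPolynomial.C (1 / (N : ℝ)) -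
          MvPolynomial.C (2 / (N : ℝ)) * MvPolynomial.X i)) (Polynomial.Chebyshev.T ℝ (k : ℤ))) ^ 2) x =
      Real.cos (k * Real.arccos ((1 / (N : ℝ)) * ∑ i, (1 - 2 * (if x i then (1 : ℝ) else 0)))) ^ 2 := by
  have hb := abs_evalBool_signMean_le hN x
  rw [evalBool_signMean] at hb
  rw [evalBool_chebyshevT_sq]
  exact eval_chebyshevT_sq_eq_cos_sq k (neg_le_of_abs_le hb) (le_of_abs_le hb)

/-! ### §4 Exact statistics: mean and variance through two oscillatory cube averages

With `t₂(x) := T_{2k}(ȳ(x))` and `t₄(x) := T_{4k}(ȳ(x))`: `p_k = (1 + t₂)/2` and `(p_k − 1/2)² = (1 + t₄)/8`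
pointwise, hence `E p_k = 1/2 + E t₂/2` and `Var[p_k] = 1/8 + E t₄/8 − (E t₂)²/4` EXACTLY. The variance
lower bound of the calibration (`Var[p_k] ≥ 5/64` at `N ≍ k²`) is thereby reduced to the two oscillatory
binomial averages `|E T_{2k}(ȳ)| ≤ 1/4`, `E T_{4k}(ȳ) ≥ −1/4` (numerics: `E T_{2k}(ȳ) → e^{−2k²/N}`). -/

/-- A centred second moment through an arbitrary centre: `E (f − E f)² = E (f − c)² − (E f − c)²`.
[folklore] -/
theorem avg_sq_sub_avg_eq (f : (Fin N → Bool) → ℝ) (c : ℝ) :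
    boolAvg (fun x => (f x - boolAvg f) ^ 2) =
      boolAvg (fun x => (f x - c) ^ 2) - (boolAvg f - c) ^ 2 := by
  have h : (fun x => (f x - boolAvg f) ^ 2) =
      fun x => ((f x - c) ^ 2 + (-2 * (boolAvg f - c)) * f x) + (boolAvg f - c) * (boolAvg f + c) := by
    funext x; ring
  rw [h, avg_add, avg_add, avg_const_mul, boolAvg_const]
  ring

/-- Pointwise half-angle form of the family: `p_k(x) = (1 + T_{2k}(ȳ(x)))/2`. [folklore] -/
theorem evalBool_chebyshevT_sq_eq_half (k : ℕ) (x : Fin N → Bool) :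
    evalBool ((Polynomial.aeval (∑ i : Fin N, (MvPolynomial.C (1 / (N : ℝ)) -
          MvPolynomial.C (2 / (N : ℝ)) * MvPolynomial.X i)) (Polynomial.Chebyshev.T ℝ (k : ℤ))) ^ 2) x =
      (1 + (Polynomial.Chebyshev.T ℝ (2 * (k : ℤ))).eval
        ((1 / (N : ℝ)) * ∑ i, (1 - 2 * (if x i then (1 : ℝ) else 0)))) / 2 := by
  rw [evalBool_chebyshevT_sq, eval_chebyshevT_sq_eq_half]

/-- Pointwise: `(p_k(x) − 1/2)² = (1 + T_{4k}(ȳ(x)))/8`. [folklore] -/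
theorem evalBool_chebyshevT_sq_sub_half_sq (k : ℕ) (x : Fin N → Bool) :
    (evalBool ((Polynomial.aeval (∑ i : Fin N, (MvPolynomial.C (1 / (N : ℝ)) -
          MvPolynomial.C (2 / (N : ℝ)) * MvPolynomial.X i)) (Polynomial.Chebyshev.T ℝ (k : ℤ))) ^ 2) x
        - 1 / 2) ^ 2 =
      (1 + (Polynomial.Chebyshev.T ℝ (4 * (k : ℤ))).eval
        ((1 / (N : ℝ)) * ∑ i, (1 - 2 * (if x i then (1 : ℝ) else 0)))) / 8 := by
  rw [evalBool_chebyshevT_sq_eq_half]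
  have h := eval_chebyshevT_sq_eq_half (2 * k) ((1 / (N : ℝ)) * ∑ i, (1 - 2 * (if x i then (1 : ℝ) else 0)))
  have e1 : ((2 * k : ℕ) : ℤ) = 2 * (k : ℤ) := by push_cast; ring
  have e2 : (2 : ℤ) * (2 * (k : ℤ)) = 4 * (k : ℤ) := by ring
  rw [e1] at h
  rw [e2] at h
  linear_combination h / 4

/-- **Mean of the Chebyshev family**: `E p_k = 1/2 + E[T_{2k}(ȳ)]/2`. [folklore] -/
theorem boolAvg_chebyshevT_sq (k : ℕ) :
    boolAvg (evalBool ((Polynomial.aeval (∑ i : Fin N, (MvPolynomial.C (1 / (N : ℝ)) -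
          MvPolynomial.C (2 / (N : ℝ)) * MvPolynomial.X i)) (Polynomial.Chebyshev.T ℝ (k : ℤ))) ^ 2)) =
      1 / 2 + boolAvg (fun x : Fin N → Bool => (Polynomial.Chebyshev.T ℝ (2 * (k : ℤ))).eval
        ((1 / (N : ℝ)) * ∑ i, (1 - 2 * (if x i then (1 : ℝ) else 0)))) / 2 := by
  have h : evalBool ((Polynomial.aeval (∑ i : Fin N, (MvPolynomial.C (1 / (N : ℝ)) -
          MvPolynomial.C (2 / (N : ℝ)) * MvPolynomial.X i)) (Polynomial.Chebyshev.T ℝ (k : ℤ))) ^ 2) =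
      fun x => 1 / 2 + (1 / 2) * (Polynomial.Chebyshev.T ℝ (2 * (k : ℤ))).eval
        ((1 / (N : ℝ)) * ∑ i, (1 - 2 * (if x i then (1 : ℝ) else 0))) := by
    funext x; rw [evalBool_chebyshevT_sq_eq_half]; ring
  rw [h, avg_add, boolAvg_const, avg_const_mul]
  ring

/-- **Exact variance identity for the Chebyshev family**:
`Var[p_k] = 1/8 + E[T_{4k}(ȳ)]/8 − (E[T_{2k}(ȳ)])²/4`. In particular `Var[p_k] ≥ 5/64` as soon as
`|E T_{2k}(ȳ)| ≤ 1/4` and `E T_{4k}(ȳ) ≥ −1/4` (the oscillatory binomial averages at `N ≍ k²`;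
numerically `E T_{2k}(ȳ) ≈ e^{−2k²/N}`, `E T_{4k}(ȳ) ≈ e^{−8k²/N}`). [folklore] -/
theorem boolVariance_chebyshevT_sq (k : ℕ) :
    boolVariance ((Polynomial.aeval (∑ i : Fin N, (MvPolynomial.C (1 / (N : ℝ)) -
          MvPolynomial.C (2 / (N : ℝ)) * MvPolynomial.X i)) (Polynomial.Chebyshev.T ℝ (k : ℤ))) ^ 2) =
      1 / 8 + boolAvg (fun x : Fin N → Bool => (Polynomial.Chebyshev.T ℝ (4 * (k : ℤ))).eval
          ((1 / (N : ℝ)) * ∑ i, (1 - 2 * (if x i then (1 : ℝ) else 0)))) / 8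
        - boolAvg (fun x : Fin N → Bool => (Polynomial.Chebyshev.T ℝ (2 * (k : ℤ))).eval
          ((1 / (N : ℝ)) * ∑ i, (1 - 2 * (if x i then (1 : ℝ) else 0)))) ^ 2 / 4 := by
  unfold boolVariance
  rw [avg_sq_sub_avg_eq _ (1 / 2), boolAvg_chebyshevT_sq]
  have h : (fun x => (evalBool ((Polynomial.aeval (∑ i : Fin N, (MvPolynomial.C (1 / (N : ℝ)) -
          MvPolynomial.C (2 / (N : ℝ)) * MvPolynomial.X i)) (Polynomial.Chebyshev.T ℝ (k : ℤ))) ^ 2) x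
        - 1 / 2) ^ 2) =
      fun x => 1 / 8 + (1 / 8) * (Polynomial.Chebyshev.T ℝ (4 * (k : ℤ))).eval
        ((1 / (N : ℝ)) * ∑ i, (1 - 2 * (if x i then (1 : ℝ) else 0))) := by
    funext x; rw [evalBool_chebyshevT_sq_sub_half_sq]; ring
  rw [h, avg_add, boolAvg_const, avg_const_mul]
  ring

/-- **Reduction of the variance floor to two oscillatory averages**: if `|E T_{2k}(ȳ)| ≤ 1/4` and
`E T_{4k}(ȳ) ≥ −1/4` then `Var[p_k] ≥ 5/64`. [folklore] -/
theorem boolVariance_chebyshevT_sq_ge (k : ℕ)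
    (h2 : |boolAvg (fun x : Fin N → Bool => (Polynomial.Chebyshev.T ℝ (2 * (k : ℤ))).eval
          ((1 / (N : ℝ)) * ∑ i, (1 - 2 * (if x i then (1 : ℝ) else 0))))| ≤ 1 / 4)
    (h4 : -(1 / 4 : ℝ) ≤ boolAvg (fun x : Fin N → Bool => (Polynomial.Chebyshev.T ℝ (4 * (k : ℤ))).eval
          ((1 / (N : ℝ)) * ∑ i, (1 - 2 * (if x i then (1 : ℝ) else 0))))) :
    5 / 64 ≤ boolVariance ((Polynomial.aeval (∑ i : Fin N, (MvPolynomial.C (1 / (N : ℝ)) -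
          MvPolynomial.C (2 / (N : ℝ)) * MvPolynomial.X i)) (Polynomial.Chebyshev.T ℝ (k : ℤ))) ^ 2) := by
  rw [boolVariance_chebyshevT_sq]
  have hsq := sq_le_sq' (abs_le.mp h2).1 (abs_le.mp h2).2
  nlinarith [hsq]

end Summit.QuantumAdvantage.QuantumAdvantage.Theorems.SosSandwich

end
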